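import Literature.AlgebraicGeometry.Resolution.PointBlowupFlagLostComponents

/-!
# Hauser–Perlega §6, Proposition 4, case (iv) in fixed coordinates: the kangaroo inequality `d_𝓖 < d_𝓕`

H. Hauser, S. Perlega, *Resolving surface singularities in positive characteristic*, Publ. RIMS Kyoto Univ. **60**
(2024) 767–813 [cite: HauserPerlega2024], proof of Prop. 4, case (iv) (`n_𝓖 > 1`, `𝓖₁ = V(z + g(x,y), x + h(y))`,
`ord h ≥ 2`), pp. 795–797: "As this is the most delicate case, we will give more background information. Let
`ω : K[[x, y]] → ℕ∞` be the weighted order that is defined via `ω(y) = 1` and `ω(x) = ord h = n_𝓖`. Denote by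
`F′₀(x, y)` the cleaned expansion of `F′(x, y)`. Let the weighted initial form `in_ω(F′₀)` have the factorization
`in_ω(F′₀) = x^a y^b · H`. By Lemma 2 we know that `d_𝓕 ≤ ord H + ε` [sic; `d_𝓖`], where `ε = p^{e−1}` if `pᵉ` divides
`ord_ω(F′₀)`, `0` otherwise. Set `𝓕₂ = V(z₀)` and `𝓕₁ = V(z₀, y₀)`, where … If `t = 0`, we set `y₀ = y` and `z₀ = 0`.
Hence, `n_𝓕 = 0`. On the other hand, if `t ≠ 0` and `E_a = V(xy)`, we set `y₀ = y − tx` … Then the equality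
`F′₀(x, y) = x^{−pᵉ} F₀(x, xy)` holds. We will now verify that the inequality `d_𝓕 ≥ n_𝓖 · ord H` holds in both cases
`n_𝓕 = 0` and `n_𝓕 = 1`. Define the weighted order function `ω̃ : K[[x, y]] → ℕ∞` via `ω̃(x) = n_𝓖`, `ω̃(y) = n_𝓖 + 1`.
Let the weighted initial form `in_ω̃(F₀)` have the expansion `in_ω̃(F₀) = x^e y^f · G`. It is straightforward to verify
that `ord G = n_𝓖 · ord H`. Hence, it remains to show that `d_𝓕 ≥ ord G`. … there is a term `x^i y^j` which appears with
non-zero coefficient in the expansion of `F₀` such that `i + j = ord F₀, i ≥ r_x` … there is a term `x^k y^l` which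
fulfills `nk + (n + 1)l = ω̃(F₀)`, `l = f + ord G`. … `ord G = l − f … ≤ j − f ≤ j − r_y = r_x − i + ord G₀ ≤ ord G₀ = d_𝓕`.
Now consider the case `n_𝓕 = 1`. … `ord G ≤ j − f ≤ j = ord_{(y)} in(F₀) = d_𝓕`. If `ε = 0`, this already implies
`d_𝓖 ≤ ord H ≤ d_𝓕/n_𝓖 < d_𝓕`. So assume that `ε = p^{e−1}`. Hence, `d_𝓖 ≤ d_𝓕/n_𝓖 + p^{e−1}`. Since we know that `pᵉ`
divides `ord_ω(F′₀)` and `d_𝓖 > 0`, the definition of `d_𝓖` implies that `d_𝓖 ≥ pᵉ`. Now recall that `n_𝓖 > 1`. Using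
this and `p ≥ 2` we can conclude that `d_𝓖 ≤ ord H + p^{e−1} ≤ d_𝓕/n_𝓖 + pᵉ/p ≤ ½(d_𝓕 + pᵉ)`. But `d_𝓖 ≥ pᵉ`, hence
`d_𝓖 ≤ d_𝓕`. Assume that `d_𝓖 = d_𝓕` holds. Then `d_𝓖 = pᵉ` and `ord H = pᵉ − p^{e−1}`. But this is not possible by Lemma 2.
It follows that the strict inequality `d_𝓖 < d_𝓕` holds, which implies `inv^𝓖_{a′}(X′) < inv^𝓕_a(X)`."

In the atlas model (two letters; chart letter `x`; `step q x b s`, `b = (0, t)`; flags `FlagDatum`; `dCurv`, `dFlag`,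
`dRes`, `invCaseN0`, `invCaseTangent` of `PointBlowupFlagInvariant`; `flatInitial` and Lemma 2
`dCurv_le_ordH` / `dCurv_lt_of_ordH_eq` of `PointBlowupFlagTangentBound`), on top of the dictionary
`PointBlowupFlagTranslatedStep` (`F′ = chartTransform q x F₀`, `F₀ = F_t` the clean sheared expansion) and
`PointBlowupFlagLostComponents` (`exists_dt_shearFlag`, terminal readings):

* `pkgWeight_chartExponent_add`, `minPkgWeight_chartTransform` — the chart `(a, c) ↦ (a + c − q, c)` carries the
  `ω̃`-weight `n·a + (n+1)·c` to the `ω`-weight plus `n·q`; `coeff_flatInitial_apply`,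
  `exists_of_coeff_flatInitial_ne_zero'` — `P♭` (the flattened `in_ω(F′)`, indexed by `x`-exponents) and the
  least-weight monomials; `exists_initial_pair_of_chartTransform` — **"`ord G = n_𝓖 · ord H`"** in the form
  `n·(deg P♭ − tdeg P♭) + d_hi(y) = d_lo(y)` for two least-`ω̃`-weight monomials of `F₀`;
  `apply_le_of_weight_le_of_degree_le` — **"`l ≤ j`"**; `kangaroo_arith` — the quoted arithmetic endgame.
* `invCaseTangent_step_lt_invCaseN0_shearFlag` — **case (iv) with `n_𝓕 = 0`** (`t = 0`, or `t ≠ 0` with the lost letter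
  `y` not exceptional: the paper's "`t ≠ 0` and `E_a = V(x)` … transformed into the first case by replacing `y` by
  `y + tx`", here the flag `Φ_t = ⟨y, x, −t·X⟩` of case (i)): `(d_𝓖, n_𝓖, 0) < (d_res, 0, s_𝓕)`.
* `invCaseTangent_step_lt_invCaseTangent_shearFlag` — **case (iv) with `n_𝓕 = 1`** (`t ≠ 0`, `E_a = V(xy)`; the tangent
  flag `Φ_t`): `(d_𝓖, n_𝓖, 0) < (d_𝓕, 1, 0)`.

Both for every field of characteristic `p` (`q = pᵉ`, `e ≥ 1`), `F` clean of order `> q`, `n_𝓖 ≥ 2`, under the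
printed non-terminality hypotheses (at `a` for the first, at `a′` for both).  The remaining configuration of the
fixed-letter model — `t ≠ 0` with `y` exceptional and `x` not — is the paper's "by symmetry" reduction and is NOT
covered here (on the game side it is avoided by reading a translated point in the chart of the exceptional letter).
Together with cases (i), (iii) this yields the case-(iv) clause of `FlagInvariantDropsStatement`.
-/

noncomputable section

open MvPolynomial Finset
open scoped BigOperators

namespace Literature.AlgebraicGeometry.Resolution

open Literature.AlgebraicGeometry.Resolution.Hauser2010
open Literature.AlgebraicGeometry.Resolution.PointBlowup
open Literature.AlgebraicGeometry.Resolution.HauserWagner2014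
open Literature.AlgebraicGeometry.Resolution.WeightedBlowup
open Literature.Barriers.ResolutionOfSingularities

namespace HauserPerlega2024

/-! ## 0. Two letters (private plumbing) -/

section TwoLetters

variable {σ : Type*}

/-- two letters: `univ = {x, y}`. [folklore] -/
private theorem univ_eq_pair_of_two [Fintype σ] [DecidableEq σ] {x y : σ} (hσ : ∀ l, l = x ∨ l = y) :
    (Finset.univ : Finset σ) = {x, y} := by
  ext l
  simp only [Finset.mem_univ, Finset.mem_insert, Finset.mem_singleton, true_iff]
  exact hσ l

/-- two letters: a sum over all letters has two terms. [folklore] -/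
private theorem sum_letters_two [Fintype σ] [DecidableEq σ] {M : Type*} [AddCommMonoid M] {x y : σ} (hxy : x ≠ y)
    (hσ : ∀ l, l = x ∨ l = y) (f : σ → M) : ∑ l, f l = f x + f y := by
  rw [univ_eq_pair_of_two hσ, Finset.sum_pair hxy]

/-- Evaluation of `a·e_x + b·e_y` at `x`. [folklore] -/
private theorem single_add_single_apply_fst {x y : σ} (hxy : x ≠ y) (a b : ℕ) :
    (Finsupp.single x a + Finsupp.single y b) x = a := by
  rw [Finsupp.add_apply, Finsupp.single_eq_same, Finsupp.single_eq_of_ne hxy, add_zero]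

/-- Evaluation of `a·e_x + b·e_y` at `y`. [folklore] -/
private theorem single_add_single_apply_snd {x y : σ} (hxy : x ≠ y) (a b : ℕ) :
    (Finsupp.single x a + Finsupp.single y b) y = b := by
  rw [Finsupp.add_apply, Finsupp.single_eq_same, Finsupp.single_eq_of_ne (Ne.symm hxy), zero_add]

end TwoLetters

/-! ## 1. The weighted transport, `ord G = n · ord H`, `l ≤ j`, and the arithmetic endgame -/

section Kangaroo

variable {σ : Type*} {K : Type*} [Field K] [Fintype σ] [DecidableEq σ]

/-- **Weights under the chart**: the `ω`-weight (`ω(y) = 1`, `ω(x) = n`) of the image `x^{a+c−q} y^c` of `x^a y^c`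
(`q ≤ a + c`) is its `ω̃`-weight `n·a + (n+1)·c` minus `n·q` (`ω̃(x) = n`, `ω̃(y) = n + 1`).
[cite: HauserPerlega2024, §6 p. 796 (the weighted order functions ω and ω̃)] -/
theorem pkgWeight_chartExponent_add {x y : σ} (hxy : x ≠ y) (hσ : ∀ l, l = x ∨ l = y) (q n : ℕ) {d : σ →₀ ℕ}
    (hd : q ≤ d.degree) : pkgWeight y n (chartExponent q x d) + n * q = n * d x + (n + 1) * d y := by
  have hσ' : ∀ l, l = y ∨ l = x := fun l => (hσ l).symm
  rw [pkgWeight_eq_two hxy hσ' n, chartExponent_two hxy hσ, single_add_single_apply_fst hxy,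
    single_add_single_apply_snd hxy]
  rw [degree_eq_two hxy hσ] at hd
  zify [hd]
  ring

/-- **The least `ω`-weight of the chart transform is the least `ω̃`-weight of `F₀` minus `n·q`** (no truncation): it is
attained, and it is a lower bound. [cite: HauserPerlega2024, §6 p. 796 (in_ω̃(F₀) and in_ω(F′₀))] -/
theorem minPkgWeight_chartTransform {x y : σ} (hxy : x ≠ y) (hσ : ∀ l, l = x ∨ l = y) (q n : ℕ)
    {G : MvPolynomial σ K} (hG0 : G ≠ 0) (hG : ∀ d ∈ G.support, q ≤ d.degree) :
    (∃ d ∈ G.support, minPkgWeight y n (chartTransform q x G) + n * q = n * d x + (n + 1) * d y) ∧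
    ∀ d ∈ G.support, minPkgWeight y n (chartTransform q x G) + n * q ≤ n * d x + (n + 1) * d y := by
  constructor
  · obtain ⟨e, he, hew⟩ := exists_pkgWeight_eq_minPkgWeight y n (chartTransform_ne_zero q x hG0 hG)
    rw [support_chartTransform q x hG, Finset.mem_image] at he
    obtain ⟨d, hd, rfl⟩ := he
    exact ⟨d, hd, by rw [← hew, pkgWeight_chartExponent_add hxy hσ q n (hG d hd)]⟩
  · intro d hd
    have hmem : chartExponent q x d ∈ (chartTransform q x G).support := by
      rw [support_chartTransform q x hG]; exact Finset.mem_image_of_mem _ hd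
    have := minPkgWeight_le y n hmem
    rw [← pkgWeight_chartExponent_add hxy hσ q n (hG d hd)]
    omega

/-- With two letters the least-weight monomials of `F′` are read off the flattened initial form: a monomial `e` of the
weighted initial form gives the non-zero coefficient `[x^{e_x} y^{e_y}]F′` of `Y^{e_x}` in `P♭`.
[cite: HauserPerlega2024, §5 p. 784 (in_ω(F)); §6 Lemma 2 p. 789 (in_ω(F) = x^a y^b·H)] -/
theorem coeff_flatInitial_apply {x y : σ} (hxy : x ≠ y) (hσ : ∀ l, l = x ∨ l = y) (n : ℕ)
    {F : MvPolynomial σ K} {e : σ →₀ ℕ} (he : e ∈ (pkgInitial y n F).support) :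
    (flatInitial y x n F).coeff (e x) = coeff e F := by
  classical
  have hσ' : ∀ l, l = y ∨ l = x := fun l => (hσ l).symm
  unfold flatInitial
  rw [Polynomial.finsetSum_coeff, Finset.sum_eq_single e]
  · rw [Polynomial.coeff_monomial, if_pos rfl]
  · intro e' he' hne
    rw [Polynomial.coeff_monomial, if_neg]
    intro hx
    apply hne
    obtain ⟨-, hw'⟩ := mem_support_pkgInitial.mp he'
    obtain ⟨-, hw⟩ := mem_support_pkgInitial.mp he
    rw [pkgWeight_eq_two hxy hσ'] at hw hw'
    rw [hx] at hw'
    rw [finsupp_eq_single_add_single hxy hσ e', finsupp_eq_single_add_single hxy hσ e, hx]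
    congr 2
    omega
  · intro h; exact absurd he h

omit [Fintype σ] [DecidableEq σ] in
/-- Conversely a non-zero coefficient of `P♭` comes from a least-weight monomial with that `x`-exponent.
[cite: HauserPerlega2024, §5 p. 784 (in_ω(F)); §6 Lemma 2 p. 789 (in_ω(F) = x^a y^b·H)] -/
theorem exists_of_coeff_flatInitial_ne_zero' (x y : σ) (n : ℕ) {F : MvPolynomial σ K} {k : ℕ}
    (hk : (flatInitial y x n F).coeff k ≠ 0) : ∃ e ∈ (pkgInitial y n F).support, e x = k := by
  classical
  by_contra h
  push Not at h
  apply hk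
  unfold flatInitial
  rw [Polynomial.finsetSum_coeff]
  refine Finset.sum_eq_zero fun e he => ?_
  rw [Polynomial.coeff_monomial, if_neg (h e he)]

/-- **`ord G = n · ord H`** ([HP24, p. 796]: `in_ω̃(F₀) = x^e y^f·G`, `in_ω(F′₀) = x^a y^b·H`), in the form used: for the
chart transform `F′ = chartTransform q x F₀` and the flattened weighted initial form `P♭` of `F′` (`ω(y) = 1`,
`ω(x) = n`), there are least-`ω̃`-weight monomials `d_lo, d_hi` of `F₀` with
`n·(deg P♭ − tdeg P♭) + d_hi(y) = d_lo(y)` — so `n·ord H = d_lo(y) − d_hi(y) ≤` (the largest `y`-exponent on the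
`ω̃`-initial line) − (the least one) `= ord G`. [cite: HauserPerlega2024, §6 p. 796 ("It is straightforward to verify that ord G = n_𝓖 · ord H")] -/
theorem exists_initial_pair_of_chartTransform {x y : σ} (hxy : x ≠ y) (hσ : ∀ l, l = x ∨ l = y) (q n : ℕ)
    {G : MvPolynomial σ K} (hG0 : G ≠ 0) (hG : ∀ d ∈ G.support, q ≤ d.degree) :
    ∃ dlo ∈ G.support, ∃ dhi ∈ G.support,
      minPkgWeight y n (chartTransform q x G) + n * q = n * dlo x + (n + 1) * dlo y ∧
      minPkgWeight y n (chartTransform q x G) + n * q = n * dhi x + (n + 1) * dhi y ∧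
      n * ((flatInitial y x n (chartTransform q x G)).natDegree -
        (flatInitial y x n (chartTransform q x G)).natTrailingDegree) + dhi y = dlo y := by
  classical
  have hσ' : ∀ l, l = y ∨ l = x := fun l => (hσ l).symm
  set F' := chartTransform q x G with hF'
  set P := flatInitial y x n F' with hP
  have hF'0 : F' ≠ 0 := chartTransform_ne_zero q x hG0 hG
  -- `P ≠ 0`
  obtain ⟨e₁, he₁, he₁w⟩ := exists_pkgWeight_eq_minPkgWeight y n hF'0
  have hP0 : P ≠ 0 := by
    intro h0
    have := coeff_flatInitial_apply hxy hσ n (mem_support_pkgInitial.mpr ⟨he₁, he₁w⟩) (F := F')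
    rw [← hP, h0, Polynomial.coeff_zero] at this
    exact (MvPolynomial.mem_support_iff.mp he₁) this.symm
  -- the extreme monomials
  obtain ⟨ehi, hehi, hehix⟩ := exists_of_coeff_flatInitial_ne_zero' x y n (F := F')
    (k := P.natDegree) (by rw [Polynomial.coeff_natDegree]; exact Polynomial.leadingCoeff_ne_zero.mpr hP0)
  obtain ⟨elo, helo, helox⟩ := exists_of_coeff_flatInitial_ne_zero' x y n (F := F')
    (k := P.natTrailingDegree) (Polynomial.trailingCoeff_nonzero_iff_nonzero.mpr hP0)
  obtain ⟨hehiF, hehiw⟩ := mem_support_pkgInitial.mp hehi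
  obtain ⟨heloF, helow⟩ := mem_support_pkgInitial.mp helo
  rw [support_chartTransform q x hG, Finset.mem_image] at hehiF heloF
  obtain ⟨dhi, hdhi, rfl⟩ := hehiF
  obtain ⟨dlo, hdlo, rfl⟩ := heloF
  -- NB: the monomial of LARGEST `x`-exponent downstairs has the LEAST `y`-exponent upstairs, hence the names
  have h1 := pkgWeight_chartExponent_add hxy hσ q n (hG dhi hdhi)
  have h2 := pkgWeight_chartExponent_add hxy hσ q n (hG dlo hdlo)
  rw [hehiw] at h1
  rw [helow] at h2
  refine ⟨dlo, hdlo, dhi, hdhi, h2, h1, ?_⟩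
  rw [← hehix, ← helox, chartExponent_two hxy hσ, chartExponent_two hxy hσ, single_add_single_apply_fst hxy,
    single_add_single_apply_fst hxy]
  have h3 := hG dhi hdhi
  have h4 := hG dlo hdlo
  rw [degree_eq_two hxy hσ] at h3 h4
  have h5 : P.natTrailingDegree ≤ P.natDegree := Polynomial.natTrailingDegree_le_natDegree P
  rw [← hehix, ← helox, chartExponent_two hxy hσ, chartExponent_two hxy hσ, single_add_single_apply_fst hxy,
    single_add_single_apply_fst hxy] at h5
  zify [h3, h4, h5] at h1 h2 ⊢
  linear_combination h2 - h1

omit [Fintype σ] [DecidableEq σ] in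
/-- **`l ≤ j`** ([HP24, p. 796]: for a least-`ω̃`-weight monomial `x^k y^l` and a least-degree monomial `x^i y^j`:
"`ord F₀ = i + j ≤ k + l`" and "`ω̃(F₀) = nk + (n+1)l ≤ ni + (n+1)j`", hence `l ≤ j`).
[cite: HauserPerlega2024, §6 p. 796 (the terms x^i y^j and x^k y^l)] -/
theorem apply_le_of_weight_le_of_degree_le {x y : σ} (n : ℕ) {d d₁ : σ →₀ ℕ}
    (hw : n * d x + (n + 1) * d y ≤ n * d₁ x + (n + 1) * d₁ y) (hdeg : d₁ x + d₁ y ≤ d x + d y) :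
    d y ≤ d₁ y := by
  nlinarith [hw, hdeg, Nat.zero_le n, Nat.zero_le (d x), Nat.zero_le (d₁ x)]

/-- **The arithmetic endgame of case (iv)** ([HP24] p. 797: "If `ε = 0`, this already implies `d_𝓖 ≤ ord H ≤
d_𝓕/n_𝓖 < d_𝓕`. So assume that `ε = p^{e−1}`. Hence, `d_𝓖 ≤ d_𝓕/n_𝓖 + p^{e−1}`. Since we know that `pᵉ` divides
`ord_ω(F′₀)` and `d_𝓖 > 0`, the definition of `d_𝓖` implies that `d_𝓖 ≥ pᵉ`. Now recall that `n_𝓖 > 1`. Using this and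
`p ≥ 2` we can conclude that `d_𝓖 ≤ ord H + p^{e−1} ≤ d_𝓕/n_𝓖 + pᵉ/p ≤ ½(d_𝓕 + pᵉ)`. But `d_𝓖 ≥ pᵉ`, hence `d_𝓖 ≤ d_𝓕`.
Assume that `d_𝓖 = d_𝓕` holds. Then `d_𝓖 = pᵉ` and `ord H = pᵉ − p^{e−1}`. But this is not possible by Lemma 2.").  Here
`P1 = p^{e−1}`, `q = pᵉ ≥ 2·P1`, `dc = d^curv_𝓖`, `dG = d_𝓖`, `hthird` = the third assertion of Lemma 2.
[cite: HauserPerlega2024, §6 p. 797 (proof of Prop. 4, case (iv), conclusion)] -/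
theorem kangaroo_arith {q P1 dc dG ordH dF : ℕ} {dvd : Prop} [Decidable dvd] (hq : 2 * P1 ≤ q) (hP1 : 1 ≤ P1)
    (hdG : dG = if 0 < dc ∧ dc < q ∧ dvd then 0 else dc) (hdc : dc ≤ ordH + if dvd then P1 else 0)
    (hB : 2 * ordH ≤ dF) (hdF : 1 ≤ dF) (hthird : ordH = q - P1 → dc < q) : dG < dF := by
  by_cases hd : dvd
  · rw [if_pos hd] at hdc
    by_cases hcl : 0 < dc ∧ dc < q ∧ dvd
    · rw [hdG, if_pos hcl]; exact hdF
    · rw [if_neg hcl] at hdG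
      subst hdG
      have hcases : dG = 0 ∨ q ≤ dG := by
        by_contra h
        push Not at h
        exact hcl ⟨Nat.pos_of_ne_zero h.1, h.2, hd⟩
      rcases hcases with h0 | hge
      · omega
      · by_cases h3 : ordH = q - P1
        · have := hthird h3; omega
        · omega
  · rw [if_neg hd, add_zero] at hdc
    have hcl : ¬ (0 < dc ∧ dc < q ∧ dvd) := fun h => hd h.2.2
    rw [if_neg hcl] at hdG
    omega

variable [DecidableEq K]

/-- **[HP24, Prop. 4], case (iv), `n_𝓕 ∈ {0}` configurations** (`t = 0`, or `t ≠ 0` with the lost letter `y` not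
exceptional — the paper's "`t ≠ 0` and `E_a = V(x)`, transformed into the first case by replacing `y` by `y + tx`"): at the
point `b = (0, t)` of the `x`-chart above a clean `F` of order `> q = pᵉ` (`e ≥ 1`), for a flag `𝓖 = ⟨x, y, h⟩` at `a′`
tangent to the new exceptional component `{x = 0}` with `n_𝓖 = ord h ≥ 2`, and the flag `𝓕 = Φ_t = ⟨y, x, −t·X⟩` at `a`
(of case (i) when `y ∈ E_a → t = 0`): if neither `X` at `a` nor `X′` at `a′` is in a terminal case, then
`inv_𝓖 = (d_𝓖, n_𝓖, 0) < (d_res, 0, s_𝓕) = inv_𝓕`, i.e. `d_𝓖 < d_𝓕 = d_res`.  Chain: `d_𝓖 ≤ d^curv_𝓖 ≤ ord H + ε`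
(Lemma 2 at `a′`), `n·ord H ≤ j − ord_y F₀ ≤ ord F₀ − ord_x F₀ − ord_y F₀ ≤ d_res(E_a)` (`F₀ = F_t`; `ord_x F₀ = ord_x F`,
and `F₀ = F` when `t = 0`), then `kangaroo_arith` with Lemma 2's third assertion.  The configuration
`t ≠ 0, y ∈ E_a, x ∉ E_a` (the paper's remaining case "by symmetry") is not covered here.
[cite: HauserPerlega2024, Prop. 4 p. 793; proof of case (iv) pp. 795–797] -/
theorem invCaseTangent_step_lt_invCaseN0_shearFlag (p : ℕ) [hp : Fact p.Prime] [CharP K p] {e : ℕ} (he : 1 ≤ e)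
    {x y : σ} (hxy : x ≠ y) (hσ : ∀ l, l = x ∨ l = y) (s : State σ K) (b : σ → K) (hbx : b x = 0)
    (hN0 : y ∈ excLetters s → b y = 0) (hF : s.F ≠ 0) (hclean : deletePthPowers (p ^ e) s.F = s.F)
    (hord : ((p ^ e : ℕ) : ℕ∞) < ordZero s.F) (hnts : ¬ IsTerminalSub (p ^ e) (excLetters s) s.F)
    (hnt : ¬ IsTerminalSub (p ^ e) (excLetters (step (p ^ e) x b s)) (step (p ^ e) x b s).F)
    (h : PowerSeries K) {n : ℕ} (hordn : h.order = n) (hn : 2 ≤ n) :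
    invCaseTangent (p ^ e) ⟨x, y, h⟩ n (step (p ^ e) x b s).F <
      invCaseN0 (p ^ e) (excLetters s) ⟨y, x, (-(b y)) • PowerSeries.X⟩ s.F := by
  classical
  set q := p ^ e with hq
  set t := b y with ht
  set s' := step q x b s with hs'
  set E := excLetters s with hE
  set E' := excLetters s' with hE'
  set F₀ : MvPolynomial σ K := deletePthPowers q
    (MvPolynomial.aeval (fun l => if l = y then (X y + C t * X x : MvPolynomial σ K) else X l) s.F) with hF₀
  have hσ' : ∀ l, l = y ∨ l = x := fun l => (hσ l).symm
  have hP1 : 1 ≤ p ^ (e - 1) := Nat.one_le_pow _ _ hp.out.pos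
  have hq2 : 2 * p ^ (e - 1) ≤ q := by
    rw [hq, show e = (e - 1) + 1 by omega, pow_succ, Nat.add_sub_cancel, mul_comm]
    exact Nat.mul_le_mul_left _ hp.out.two_le
  -- the order of `F`
  obtain ⟨o, ho'⟩ := WithTop.ne_top_iff_exists.mp (show ordZero s.F ≠ ⊤ by
    unfold ordZero; rw [Ne, MvPowerSeries.order_eq_top_iff, MvPolynomial.coe_eq_zero_iff]; exact hF)
  have ho : ordZero s.F = o := ho'.symm
  have hqo : q < o := by rw [ho] at hord; exact_mod_cast hord
  -- the dictionary and the orders of `F₀`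
  have hstep : s'.F = chartTransform q x F₀ :=
    step_F_eq_chartTransform_clean_shear hxy hσ q b hbx s (by rw [ho]; exact_mod_cast hqo.le)
  have hoF₀ : ordZero F₀ = o := by rw [hF₀, ordZero_cleanShear_eq hxy hσ q t hF hclean, ho]
  have hF₀ne : F₀ ≠ 0 := by
    intro h0; rw [h0, ordZero_zero] at hoF₀; exact WithTop.top_ne_natCast o hoF₀
  obtain ⟨⟨d₁, hd₁, hd₁deg⟩, hmin₀⟩ := exists_mem_support_degree_eq hoF₀
  have hsuppq : ∀ d ∈ F₀.support, q ≤ d.degree := fun d hd => hqo.le.trans (hmin₀ d hd)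
  have hs'ne : s'.F ≠ 0 := by rw [hstep]; exact chartTransform_ne_zero q x hF₀ne hsuppq
  have hs'clean : deletePthPowers q s'.F = s'.F := deletePthPowers_step q x b s
  have hordxF₀ : ordVar F₀ x = ordVar s.F x := by rw [hF₀]; exact ordVar_cleanShear_self hxy hσ q t hF hclean
  -- Lemma 2 at `a′` for the flag `⟨x, y, h⟩`
  obtain ⟨hwo, hcurv⟩ := dCurv_le_ordH p y x (Ne.symm hxy) hσ' h hordn hs'ne hs'clean (e := e)
  set P := flatInitial y x n s'.F with hP
  set ordH := P.natDegree - P.natTrailingDegree with hordH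
  -- `n · ord H ≤ o − ord_x F₀ − ord_y F₀`
  obtain ⟨dlo, hdlo, dhi, hdhi, hwlo, hwhi, hpair⟩ :=
    exists_initial_pair_of_chartTransform hxy hσ q n hF₀ne hsuppq (K := K)
  rw [← hstep] at hwlo hwhi hpair
  obtain ⟨-, hWmin⟩ := minPkgWeight_chartTransform hxy hσ q n hF₀ne hsuppq (K := K)
  simp only [← hstep] at hWmin
  have hB : n * ordH ≤ o - ordVar F₀ x - ordVar F₀ y := by
    have h1 : dlo y ≤ d₁ y := apply_le_of_weight_le_of_degree_le n (hwlo ▸ hWmin d₁ hd₁)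
      (by rw [← degree_eq_two hxy hσ, ← degree_eq_two hxy hσ, hd₁deg]; exact hmin₀ dlo hdlo)
    have h2 : ordVar F₀ y ≤ dhi y := ordVar_le_of_mem_support hdhi y
    have h3 : ordVar F₀ x ≤ d₁ x := ordVar_le_of_mem_support hd₁ x
    rw [degree_eq_two hxy hσ] at hd₁deg
    rw [← hordH] at hpair
    omega
  -- `d_𝓕 = d_res(E) ≥ o − ord_x F₀ − ord_y F₀`, and `d_𝓕 ≥ 1`
  have hdres : o - ordVar F₀ x - ordVar F₀ y ≤ dRes E s.F := by
    by_cases hyE : y ∈ E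
    · -- `t = 0`: `F₀ = F`
      have ht0 : t = 0 := hN0 hyE
      have hF₀F : F₀ = s.F := by
        rw [hF₀, ht0]
        have hfun : (fun l => if l = y then (X y + C (0 : K) * X x : MvPolynomial σ K) else X l) = X := by
          funext l; split_ifs with hl
          · rw [hl, map_zero, zero_mul, add_zero]
          · rfl
        rw [hfun, MvPolynomial.aeval_X_left_apply, hclean]
      rw [hF₀F]
      refine le_trans ?_ (dRes_mono (Finset.subset_univ E) s.F)
      unfold dRes
      rw [ho, ENat.toNat_coe, sum_letters_two hxy hσ]
      omega
    · have hEx : E ⊆ {x} := by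
        intro l hl
        rcases hσ l with rfl | rfl
        · exact Finset.mem_singleton_self _
        · exact absurd hl hyE
      refine le_trans ?_ (dRes_mono hEx s.F)
      rw [dRes_singleton, ho, ENat.toNat_coe, ← hordxF₀]
      omega
  have hdF1 : 1 ≤ dRes E s.F := by
    by_contra h0
    push Not at h0
    have h00 : dRes E s.F = 0 := by omega
    rcases E.eq_empty_or_nonempty with hE0 | hEne
    · rw [hE0, dRes_empty, ho, ENat.toNat_coe] at h00; omega
    · exact hnts (isTerminalSub_of_dRes_eq_zero hxy hσ q hEne hF hclean h00)
  -- the endgame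
  have hdG : dFlag q ⟨x, y, h⟩ n s'.F = if 0 < (dCurv q ⟨x, y, h⟩ n s'.F).toNat ∧
      (dCurv q ⟨x, y, h⟩ n s'.F).toNat < q ∧ q ∣ minPkgWeight y n s'.F then 0
      else (dCurv q ⟨x, y, h⟩ n s'.F).toNat := by
    unfold dFlag; dsimp only; rw [hwo, ENat.toNat_coe]
  have hdc : (dCurv q ⟨x, y, h⟩ n s'.F).toNat ≤ ordH + if q ∣ minPkgWeight y n s'.F then p ^ (e - 1) else 0 := by
    have := ENat.toNat_le_of_le_coe hcurv
    split_ifs at this ⊢ with hd <;> omega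
  have hthird : ordH = q - p ^ (e - 1) → (dCurv q ⟨x, y, h⟩ n s'.F).toNat < q := by
    intro h3
    have hlt := dCurv_lt_of_ordH_eq (p := p) he y x (Ne.symm hxy) hσ' h hordn hs'ne hs'clean (by rw [← hP]; exact h3)
    have hfin : dCurv q ⟨x, y, h⟩ n s'.F ≠ ⊤ := ne_top_of_lt hlt
    rw [← ENat.coe_toNat hfin] at hlt
    exact_mod_cast hlt
  have h2n : 2 * ordH ≤ n * ordH := Nat.mul_le_mul_right _ hn
  have hlt : dFlag q ⟨x, y, h⟩ n s'.F < dRes E s.F :=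
    kangaroo_arith hq2 hP1 hdG hdc (by omega) hdF1 hthird
  unfold invCaseTangent invCaseN0
  exact Prod.Lex.toLex_lt_toLex.mpr (Or.inl hlt)

/-- **[HP24, Prop. 4], case (iv), `n_𝓕 = 1` configuration** (`t ≠ 0` and `E_a = V(xy)`): at the point `b = (0, t)`,
`t ≠ 0`, of the `x`-chart above a clean `F` of order `> q = pᵉ` (`e ≥ 1`), for a flag `𝓖 = ⟨x, y, h⟩` at `a′` tangent to
the new exceptional component with `n_𝓖 = ord h ≥ 2`, and the tangent flag `𝓕 = Φ_t = ⟨y, x, −t·X⟩` at `a` (`n_𝓕 = 1`,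
adapted when both letters are exceptional): if `X′` is not in a terminal case at `a′`, then
`inv_𝓖 = (d_𝓖, n_𝓖, 0) < (d_𝓕, 1, 0) = inv_𝓕`, i.e. `d_𝓖 < d_𝓕 = d_t`.  Chain: `d_𝓖 ≤ d^curv_𝓖 ≤ ord H + ε`,
`n·ord H ≤ l ≤ j = ord_{(y)} in(F₀) = d_𝓕` (`exists_dt_shearFlag`: `d_𝓕 = d_t ≥ 1` by non-terminality at `a′`), then
`kangaroo_arith`. [cite: HauserPerlega2024, Prop. 4 p. 793; proof of case (iv) pp. 795–797 ("Now consider the case n_𝓕 = 1")] -/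
theorem invCaseTangent_step_lt_invCaseTangent_shearFlag (p : ℕ) [hp : Fact p.Prime] [CharP K p] {e : ℕ}
    (he : 1 ≤ e) {x y : σ} (hxy : x ≠ y) (hσ : ∀ l, l = x ∨ l = y) (s : State σ K) (b : σ → K) (hbx : b x = 0)
    (hF : s.F ≠ 0) (hclean : deletePthPowers (p ^ e) s.F = s.F) (hord : ((p ^ e : ℕ) : ℕ∞) < ordZero s.F)
    (hnt : ¬ IsTerminalSub (p ^ e) (excLetters (step (p ^ e) x b s)) (step (p ^ e) x b s).F)
    (h : PowerSeries K) {n : ℕ} (hordn : h.order = n) (hn : 2 ≤ n) :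
    invCaseTangent (p ^ e) ⟨x, y, h⟩ n (step (p ^ e) x b s).F <
      invCaseTangent (p ^ e) ⟨y, x, (-(b y)) • PowerSeries.X⟩ 1 s.F := by
  classical
  set q := p ^ e with hq
  set t := b y with ht
  set s' := step q x b s with hs'
  set F₀ : MvPolynomial σ K := deletePthPowers q
    (MvPolynomial.aeval (fun l => if l = y then (X y + C t * X x : MvPolynomial σ K) else X l) s.F) with hF₀
  have hσ' : ∀ l, l = y ∨ l = x := fun l => (hσ l).symm
  have hP1 : 1 ≤ p ^ (e - 1) := Nat.one_le_pow _ _ hp.out.pos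
  have hq2 : 2 * p ^ (e - 1) ≤ q := by
    rw [hq, show e = (e - 1) + 1 by omega, pow_succ, Nat.add_sub_cancel, mul_comm]
    exact Nat.mul_le_mul_left _ hp.out.two_le
  obtain ⟨o, ho'⟩ := WithTop.ne_top_iff_exists.mp (show ordZero s.F ≠ ⊤ by
    unfold ordZero; rw [Ne, MvPowerSeries.order_eq_top_iff, MvPolynomial.coe_eq_zero_iff]; exact hF)
  have ho : ordZero s.F = o := ho'.symm
  have hqo : q < o := by rw [ho] at hord; exact_mod_cast hord
  have hstep : s'.F = chartTransform q x F₀ :=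
    step_F_eq_chartTransform_clean_shear hxy hσ q b hbx s (by rw [ho]; exact_mod_cast hqo.le)
  have hoF₀ : ordZero F₀ = o := by rw [hF₀, ordZero_cleanShear_eq hxy hσ q t hF hclean, ho]
  have hF₀ne : F₀ ≠ 0 := by
    intro h0; rw [h0, ordZero_zero] at hoF₀; exact WithTop.top_ne_natCast o hoF₀
  obtain ⟨-, hmin₀⟩ := exists_mem_support_degree_eq hoF₀
  have hsuppq : ∀ d ∈ F₀.support, q ≤ d.degree := fun d hd => hqo.le.trans (hmin₀ d hd)
  have hs'ne : s'.F ≠ 0 := by rw [hstep]; exact chartTransform_ne_zero q x hF₀ne hsuppq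
  have hs'clean : deletePthPowers q s'.F = s'.F := deletePthPowers_step q x b s
  -- the situation at `a`: `d_𝓕 = d_t = d₀ y ≥ 1`
  obtain ⟨d₀, hd₀, hd₀deg, -, hdFlag, hpos, -, -⟩ := exists_dt_shearFlag hxy hσ q s b hbx hF hclean ho hqo hnt
  -- Lemma 2 at `a′`
  obtain ⟨hwo, hcurv⟩ := dCurv_le_ordH p y x (Ne.symm hxy) hσ' h hordn hs'ne hs'clean (e := e)
  set P := flatInitial y x n s'.F with hP
  set ordH := P.natDegree - P.natTrailingDegree with hordH
  obtain ⟨dlo, hdlo, dhi, hdhi, hwlo, hwhi, hpair⟩ :=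
    exists_initial_pair_of_chartTransform hxy hσ q n hF₀ne hsuppq (K := K)
  rw [← hstep] at hwlo hwhi hpair
  obtain ⟨-, hWmin⟩ := minPkgWeight_chartTransform hxy hσ q n hF₀ne hsuppq (K := K)
  simp only [← hstep] at hWmin
  have hB : n * ordH ≤ d₀ y := by
    have h1 : dlo y ≤ d₀ y := apply_le_of_weight_le_of_degree_le n (hwlo ▸ hWmin d₀ hd₀)
      (by rw [← degree_eq_two hxy hσ, ← degree_eq_two hxy hσ, hd₀deg]; exact hmin₀ dlo hdlo)
    rw [← hordH] at hpair
    omega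
  have hdG : dFlag q ⟨x, y, h⟩ n s'.F = if 0 < (dCurv q ⟨x, y, h⟩ n s'.F).toNat ∧
      (dCurv q ⟨x, y, h⟩ n s'.F).toNat < q ∧ q ∣ minPkgWeight y n s'.F then 0
      else (dCurv q ⟨x, y, h⟩ n s'.F).toNat := by
    unfold dFlag; dsimp only; rw [hwo, ENat.toNat_coe]
  have hdc : (dCurv q ⟨x, y, h⟩ n s'.F).toNat ≤ ordH + if q ∣ minPkgWeight y n s'.F then p ^ (e - 1) else 0 := by
    have := ENat.toNat_le_of_le_coe hcurv
    split_ifs at this ⊢ with hd <;> omega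
  have hthird : ordH = q - p ^ (e - 1) → (dCurv q ⟨x, y, h⟩ n s'.F).toNat < q := by
    intro h3
    have hlt := dCurv_lt_of_ordH_eq (p := p) he y x (Ne.symm hxy) hσ' h hordn hs'ne hs'clean (by rw [← hP]; exact h3)
    have hfin : dCurv q ⟨x, y, h⟩ n s'.F ≠ ⊤ := ne_top_of_lt hlt
    rw [← ENat.coe_toNat hfin] at hlt
    exact_mod_cast hlt
  have h2n : 2 * ordH ≤ n * ordH := Nat.mul_le_mul_right _ hn
  have hlt : dFlag q ⟨x, y, h⟩ n s'.F < d₀ y := kangaroo_arith hq2 hP1 hdG hdc (by omega) hpos hthird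
  unfold invCaseTangent
  rw [hdFlag]
  exact Prod.Lex.toLex_lt_toLex.mpr (Or.inl hlt)

end Kangaroo

end HauserPerlega2024

end Literature.AlgebraicGeometry.Resolution

end
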